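import Summits.ABC.IUTFork.Joshi.TestDictionaryCalibrationPlaces
import Summits.ABC.IUTFork.Cor312GapWitnessProvenance
import HarnessLib

/-!
# Branch E TEST vs S — the calibration across places, II: S ∧ ¬ UniformIndRelated (S as typed is packet-local)

Record file of the abc-iut cell, branch E (rung LADDER-ABC:A2.E; seat abc-iut-E-t42 gen 2, row T-42c, part 2; companion of
`Joshi/TestDictionaryCalibrationPlaces.lean`). **No side is taken** on [IUTchIII] Cor. 3.12 or on any author (Mochizuki / Scholze–Stix /
Joshi); typed ≠ proved; INTERFACE-LEVEL instantiation (declared as such): of the frozen binders `(S, P, ρ, qK)` the two Props compared —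
S := `PilotKummerIndRelated` (abc-iut-w5-d230) and `UniformIndRelated` (abc-iut-E-t42 p430744) — read only the line datum `D_n.Ψ`, the
region-forming operator `ρ` and the q-datum `qK`; every other field of the situation / setting is a point (abc-iut-w4-d026's
index-generic `GapWitnessProv.pointSig`, `Cor312.Checks.toyFrame`). This is a LOGICAL separation of two Props over the same binders,
NOT a model of the typed Theorem 3.11 or of the pins (the one-place models of record — pinned countermodel p419720, X-07′ p431588,
floor p429619 — are all place-separable, where the two Props coincide, part 1 §2).

CONTENT. Over part 1's two-place index `TwoPlace.index` and permutation-detecting rigid shells `TwoPlace.shells`: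
* the line datum `Ψ_v := {ψ₀}` with `ψ₀ = (t₀)_j`, `t₀ = e₀ ⊗ e₁ ⊗ ⋯ ⊗ e₁`; `ρ(Ψ)_{j,v_ℚ}` := the `j`-components of `Ψ` at the valuation
  over `v_ℚ` (the whole packet at label `0`) — (hρ) holds for EVERY packet-automorphism family (`rho_equivariant`); the q-datum
  `qK := mixed · Ψ` (identity at `v_ℚ⁰`, swap of the factors `0, j` at `v_ℚ¹`);
* `pilotKummerIndRelated_twoPlace` — **S HOLDS**: at `(j, v_ℚ)` the possible image `D_n · placeWitness(v_ℚ)` does it (a DIFFERENT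
  element of `⟨(Ind1) ∪ (Ind2)⟩` at each place);
* `not_uniformIndRelated_twoPlace` — **the uniform residual FAILS**: one element of `⟨(Ind1) ∪ (Ind2)⟩` is a diagonal capsule
  permutation (part 1 `exists_eq_permFamily_of_rigid`); at `(j⋆, v_ℚ⁰)` it must fix `t₀`, at `(j⋆, v_ℚ¹)` move it like the swap —
  impossible (part 1's detector); hence `not_dictionaryRealizable_twoPlace` (X-01's hypothesis set fails where S holds);
* `pilotKummerIndRelated_not_imp_uniformIndRelated` — the package: (hρ) ∧ ¬IndPlaceSeparable ∧ S ∧ ¬UniformIndRelated ∧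
  ¬DictionaryRealizable at one instantiation of the frozen binders.
READING (R9-style, located not adjudicated): «CALIBRATION X-10 MULTI-PLACE: X-01's hypothesis set / every ONE-indeterminacy
(IndTranslate) line is S-EQUIVALENT exactly at place-separable indices (part 1 §2; all models of record) and STRICTLY STRONGER than S in
general (this file); the excess is (Ind1)'s diagonal capsule permutation ([IUTchIII] Thm. 3.11 (i) p. 154; `LogShells.Ind1`)».
[claim: Mochizuki2012, status: disputed] [claim: Joshi2024ATS3, status: disputed] [cite: ScholzeStix2018, §2.2 pp. 9–10]
-/

noncomputable section

open Set

namespace Summit.ABC.IUTFork.Joshi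

open Thm311 Cor312 Cor312Vol Literature.IUT.LogThetaLattice

/-! ## 1. The instantiation of S's binders at the two-place index -/

namespace TwoPlace

open Cor312.Checks Cor312Vol.GapWitnessProv

/-- The bad-place datum: at valuation `v`, the ONE star-packet element `(t₀)_{j ∈ 𝔽_l^⋇}`. [folklore] -/
def psi0 (v : index.V) : shells.StarPacket v := fun j => t0 j.1 (index.over v)

/-- Data (a)(b)(c) of the line: everything admissible, log-volume `0`, splitting-monoid datum `{ψ₀}`, no number field (interface level:
only the field `Ψ` is read by S / `UniformIndRelated`). [folklore] -/
def data : MRData shells where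
  shellPk := fun _ _ => Set.univ
  shellSub := fun _ _ => Set.univ
  Adm := fun _ _ _ => True
  logvol := fun _ _ _ => 0
  Ψ := fun v _ => {psi0 v}
  act := fun _ _ _ => 0
  Mmod := fun _ => ∅

/-- Global degrees of (c): one object, degree `0`, region everything (unread). [folklore] -/
def degrees (j : index.LabelStar) : GlobalDegrees shells j where
  ObjMOD := Unit
  Objmod := Unit
  natIso := Equiv.refl Unit
  deg := fun _ => 0
  region := fun _ _ => Set.univ

/-- A column (unread by S / `UniformIndRelated`; interface level). [folklore] -/
def column : Column shells where
  frobAdm := fun _ _ _ _ => True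
  frobLogvol := fun _ _ _ _ => 0
  frobΨ := fun _ v _ => {psi0 v}
  frobMmod := fun _ _ => ∅
  unitImage := fun _ _ _ _ => Set.univ
  ballImage := fun _ _ _ => Set.univ
  ObjLGP := Unit
  frobObjLGP := fun _ => Unit
  kumLGP := fun _ => Equiv.refl Unit
  ObjLgp := Unit
  frobObjLgp := fun _ => Unit
  kumLgp := fun _ => Equiv.refl Unit
  thetaPilot := fun _ => ()

/-- The two-place lattice situation (same data and column on every vertical line). [folklore] -/
def lattice : LatticeSituation index where
  L := shells
  D := fun _ => data
  G := fun _ j => degrees j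
  col := fun _ => column

/-- The setting over it (interface level: of its fields S reads only the column index `n := 0`; one-point pilots as in
abc-iut-w4-d026's index-generic `GapWitnessProv.pointSig`, hull frame `toyFrame`). [folklore] -/
def setting : Cor312.Setting lattice.toSituation where
  n := 0
  HT := ℤ × ℤ
  LogLink := fun _ _ => Unit
  IsFull := fun _ => True
  lattice :=
    { theater := fun n m => (n, m)
      distinct := fun p q h => by simpa using h
      logLink := fun _ _ => ()
      logLink_full := fun _ _ => trivial }
  Frd := Unit
  IsoF := fun _ _ => Unit
  Ob := fun _ => Unit
  realify := id
  Strip := Unit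
  IsoS := fun _ _ => Unit
  M := fun _ _ => Unit
  sig := pointSig
  split := { Msplit := fun _ _ => ⊤, exists_gen := fun _ _ => ⟨⟨(), trivial⟩, top_unit_isGenerator _⟩ }
  ObΔ := Unit
  N := fun _ _ => Unit
  qData := { q := fun _ _ => (), q_gen := fun _ _ => unit_isGenerator _, objOf := fun _ => () }
  frame := fun _ _ => toyFrame _
  hul_adm := fun _ _ _ _ => trivial
  thetaRegionOf := fun _ _ _ _ => Set.univ
  qRegionOf := fun _ _ _ => Set.univ
  qRegion_mem := fun _ _ => Set.mem_insert_of_mem _ rfl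
  qSupport_finite := fun _ =>
    haveI : Finite index.VQ := inferInstanceAs (Finite Bool)
    Set.toFinite _

/-- **The region-forming operator `ρ`**: at a nonzero label `j`, the set of `j`-components of the star-packet datum at the valuation over
`v_ℚ`; at label `0` (no component) the whole packet. DATA. [folklore] -/
def rho (Ψ : ∀ v : index.V, v ∈ index.Vbad → Set (shells.StarPacket v)) (j : index.Label) (vQ : index.VQ) :
    Set (shells.Packet j vQ) :=
  if h : j = 0 then Set.univ else (fun f : shells.StarPacket vQ => f ⟨j, h⟩) '' Ψ vQ (Set.mem_univ _)

/-- **(hρ) holds, for EVERY packet-automorphism family** (componentwise action): `ρ(Φ·Ψ) = Φ '' ρ(Ψ)`. [folklore] -/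
theorem rho_equivariant (Φ : shells.PacketAut) (Ψ : ∀ v : index.V, v ∈ index.Vbad → Set (shells.StarPacket v))
    (j : index.Label) (vQ : index.VQ) :
    rho (fun v hv => shells.starAut Φ v '' Ψ v hv) j vQ = Φ j vQ '' rho Ψ j vQ := by
  unfold rho
  split_ifs with h
  · exact (Set.image_univ_of_surjective (Φ j vQ).surjective).symm
  · rw [Set.image_image, Set.image_image]
    rfl

/-- (hρ) in the form the calibration consumes (restricted to `⟨(Ind1) ∪ (Ind2)⟩`). [folklore] -/
theorem rho_equivariant' : ∀ Φ ∈ Subgroup.closure (lattice.L.Ind1Family ∪ lattice.L.Ind2Family),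
    ∀ (Ψ : ∀ v : index.V, v ∈ index.Vbad → Set (lattice.L.StarPacket v)) (j : index.Label) (vQ : index.VQ),
      rho (fun v hv => lattice.L.starAut Φ v '' Ψ v hv) j vQ = Φ j vQ '' rho Ψ j vQ :=
  fun Φ _ Ψ j vQ => rho_equivariant Φ Ψ j vQ

/-- At a nonzero label the Θ-datum's region is the singleton `{t₀}`. [folklore] -/
theorem rho_data (j : index.Label) (hj : j ≠ 0) (vQ : index.VQ) : rho data.Ψ j vQ = {t0 j vQ} := by
  unfold rho
  rw [dif_neg hj]
  exact Set.image_singleton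

/-- **The q-pilot Kummer datum of the instantiation**: the Θ-datum transported by the MIXED family (identity at `v_ℚ⁰`, swap at
`v_ℚ¹`). DATA. [folklore] -/
def qK : ∀ v : index.V, v ∈ index.Vbad → Set (shells.StarPacket v) := fun v hv => shells.starAut mixed v '' data.Ψ v hv

/-- **S HOLDS at the instantiation**: at the packet `(j, v_ℚ)` the possible image transporting the Θ-region onto the q-region is
`D_n · placeWitness(v_ℚ)` — a DIFFERENT element of `⟨(Ind1) ∪ (Ind2)⟩` at each place. [folklore] -/
theorem pilotKummerIndRelated_twoPlace : PilotKummerIndRelated lattice setting rho qK := by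
  intro j vQ
  refine ⟨data.map (placeWitness vQ), MRData.map_mem_RLGP _ (placeWitness_mem vQ), ?_⟩
  show rho (fun v hv => shells.starAut mixed v '' data.Ψ v hv) j vQ =
    rho (fun v hv => shells.starAut (placeWitness vQ) v '' data.Ψ v hv) j vQ
  rw [rho_equivariant, rho_equivariant]
  rfl

/-- **The uniform residual FAILS at the instantiation**: ONE element of `⟨(Ind1) ∪ (Ind2)⟩` is a diagonal capsule permutation
(`exists_eq_permFamily_of_rigid`); at `(j⋆, v_ℚ⁰)` it must fix `t₀`, at `(j⋆, v_ℚ¹)` it must move `t₀` as the swap does. [folklore] -/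
theorem not_uniformIndRelated_twoPlace : ¬ UniformIndRelated lattice setting rho qK := by
  rintro ⟨Φ, hΦ, hEq⟩
  obtain ⟨σ, rfl⟩ := shells.exists_eq_permFamily_of_rigid shells_rigid hΦ
  have hj : jTop ≠ 0 := by decide
  have key : ∀ vQ : index.VQ,
      mixed jTop vQ '' {t0 jTop vQ} = shells.permute jTop vQ (σ jTop) '' {t0 jTop vQ} := fun vQ => by
    have h := hEq jTop vQ
    change rho (fun v hv => shells.starAut mixed v '' data.Ψ v hv) jTop vQ = _ '' rho data.Ψ jTop vQ at h
    rwa [rho_equivariant, rho_data jTop hj] at h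
  have h0 := key false
  rw [mixed_false, Set.image_singleton, Set.image_singleton, Set.singleton_eq_singleton_iff] at h0
  have hfix : σ jTop 0 = 0 := by
    by_contra h
    exact permute_t0_ne_of_not_fix jTop false h h0.symm
  have h1 := key true
  rw [mixed_true, Set.image_singleton, Set.image_singleton, Set.singleton_eq_singleton_iff,
    permute_t0_of_fix jTop true hfix] at h1
  exact permute_t0_ne_of_not_fix jTop true sw_jTop_zero_ne h1

/-- X-01's hypothesis set FAILS at the instantiation although S holds (calibration `dictionaryRealizable_iff_uniformIndRelated`, p430744). [folklore] -/
theorem not_dictionaryRealizable_twoPlace : ¬ DictionaryRealizable lattice setting rho qK := fun h =>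
  not_uniformIndRelated_twoPlace (uniformIndRelated_of_dictionaryRealizable rho_equivariant' h)

end TwoPlace

/-! ## 2. Package -/

/-- **`pilotKummerIndRelated_not_imp_uniformIndRelated` — S AS TYPED IS PACKET-LOCAL.** There is an index (two places), a lattice
situation, a setting, a region-forming operator `ρ` satisfying (hρ) for every packet-automorphism family, and a q-datum such that
S = `PilotKummerIndRelated` HOLDS while the uniform residual `UniformIndRelated` (ONE indeterminacy for all packets) and X-01's
hypothesis set `DictionaryRealizable` FAIL; the indeterminacy subgroup there is not place-separable. LOGICAL separation of Props over
the frozen binders (interface-level instantiation: only `D_n.Ψ`, `ρ`, `qK` are read; NOT a model of the typed Thm. 3.11 or of the pins).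
With §2: the calibration «X-01's hypothesis set ⟺ S» holds EXACTLY at the place-separable indices; across places the excess of every
ONE-indeterminacy (IndTranslate / dictionary) line over S is (Ind1)'s diagonal capsule permutation — located, not adjudicated.
[claim: Mochizuki2012, status: disputed] [claim: Joshi2024ATS3, status: disputed] -/
theorem pilotKummerIndRelated_not_imp_uniformIndRelated :
    ∃ (T : ThetaIndex) (S : LatticeSituation T) (P : Cor312.Setting S.toSituation)
      (ρ : (∀ v : T.V, v ∈ T.Vbad → Set (S.L.StarPacket v)) → ∀ (j : T.Label) (vQ : T.VQ), Set (S.L.Packet j vQ))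
      (qK : ∀ v : T.V, v ∈ T.Vbad → Set (S.L.StarPacket v)),
      (∀ (Φ : S.L.PacketAut) (Ψ : ∀ v : T.V, v ∈ T.Vbad → Set (S.L.StarPacket v)) (j : T.Label) (vQ : T.VQ),
          ρ (fun v hv => S.L.starAut Φ v '' Ψ v hv) j vQ = Φ j vQ '' ρ Ψ j vQ) ∧
        ¬ IndPlaceSeparable S.L ∧ PilotKummerIndRelated S P ρ qK ∧ ¬ UniformIndRelated S P ρ qK ∧
          ¬ DictionaryRealizable S P ρ qK :=
  ⟨TwoPlace.index, TwoPlace.lattice, TwoPlace.setting, TwoPlace.rho, TwoPlace.qK, TwoPlace.rho_equivariant,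
    TwoPlace.not_indPlaceSeparable, TwoPlace.pilotKummerIndRelated_twoPlace, TwoPlace.not_uniformIndRelated_twoPlace,
    TwoPlace.not_dictionaryRealizable_twoPlace⟩

end Summit.ABC.IUTFork.Joshi

end
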